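import Mathlib
import HarnessLib
import Literature.MathematicalPhysics.KineticTheory.HardSphereEulerProofs
import Summits.AtomisticToContinuum.HydrodynamicLimit.Theses.OneFlightGossipEngine
import Summits.AtomisticToContinuum.HydrodynamicLimit.Theorems.OneFlightGossipEngineKineticCurrentsWindowLDSplit
import Summits.AtomisticToContinuum.HydrodynamicLimit.Theorems.OneFlightGossipEngineKineticCurrentsWindowLDApriori
import Summits.AtomisticToContinuum.HydrodynamicLimit.Theorems.OneFlightGossipEngineKineticCurrentsWindowLDUniformAssembly
import Summits.AtomisticToContinuum.HydrodynamicLimit.Theorems.OneFlightGossipEngineKineticCurrentsLDAlongFamiliesTransferByNets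

/-!
# The net transfer, tails eventually in `τ` — stub `stub_transferByNetsEv` of line `Sketch`,
# crux `KineticCurrentsLDAlongFamilies` (stmt-AtomisticToContinuum-16659)

Route `OneFlightGossipEngine`, sub-problem `HydrodynamicLimit`, stub S7' of the skeleton
`Cruxes/KineticCurrentsLDAlongFamilies/Lines/Sketch.lean` (v5, radial reshape; card
`skolem-only-in-beta`): the crux `KineticCurrentsLDAlongFamilies` (wrapped in `id`; window LD bound
`∫ exp(β Σᵢ w⁻¹∫₀ʷ F_s(Φ_r z i) dr) dλ^N_s ≤ exp(ε(N+1))`, `w = τ(N+1)^{-1/3}`, thresholds uniform in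
`s ∈ [0, t₁]`) from four neighbour shapes taken as hypotheses: (hK) the pointwise rung with a
NUMERIC tilt threshold `β₀(Θ, U, C, Λ, σ)` (S1); (hT) exponential moments of the window-averaged
velocity tails, uniform in `s`, under the packing guard at the tails' own level `η` and only
EVENTUALLY in the window parameter `τ` (output of S9); (hR) the static change of reference law
`∫ g dλ_{s'} ≤ (∫ g² dλ_s)^{1/2} e^{κ(N+1)}` for `|s − s'| ≤ δ` (S5); (hB) numeric bounds of the
profiles and one joint modulus of the class functional on velocity balls (S6). This is the landed
transfer `stub_transferByNets` (same folder) with the tails hypothesis weakened; the proof is the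
same finite net in `s` (S1 at the nodes with tilt `4β`, two Cauchy–Schwarz steps, the pathwise bound
`ω(N+1) + 6C·(window tails)` of the difference of two nearby class functionals), with the guard
level `η₀ := min(η₁, η_T, 1/8)` and the window threshold `τ₀ := τ₀^{net} + τ₀^{tails}`. All the
measure-theoretic steps are the helpers `tbn_*` of the landed file.

References: S. Olla, S. R. S. Varadhan, H.-T. Yau, Comm. Math. Phys. 155 (1993) §2; H. Spohn,
*Large Scale Dynamics of Interacting Particles* (1991), Part I §2.3.
-/

noncomputable section

open MeasureTheory Set Filter
open scoped ENNReal Topology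

namespace Summit.AtomisticToContinuum.HydrodynamicLimit.Theorems.KineticCurrentsLDAlongFamiliesSketch

open Literature.Analysis.FluidPDE (HardSphereFlow Config localMaxwellian canonicalDensity liouville)
open Literature.MathematicalPhysics.KineticTheory (T3 V3 hsDiameter localGibbsLaw localGibbsMeasure
  localGibbsProfile)
open Literature.Analysis.FluidPDE Literature.MathematicalPhysics.KineticTheory
open Summit.AtomisticToContinuum.HydrodynamicLimit.Theses.OneFlightGossipEngine (KineticCurrentsLDAlongFamilies)

/-- **S7' — the net transfer, tails eventually in `τ`** (stub `stub_transferByNetsEv` of line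
`Sketch`, crux `KineticCurrentsLDAlongFamilies`, stmt-AtomisticToContinuum-16659; card
`skolem-only-in-beta`): the pointwise rung with numeric tilt threshold (S1), the family window
tails under the packing guard at level `η` and eventually in `τ` (output of S9), the static change
of reference law (S5) and the family bounds/modulus (S6) imply the crux
(`id KineticCurrentsLDAlongFamilies`, unwrapped by `show`). `η₀ := min(η₁, η_T, 1/8)`,
`β₀ := min(β₁/4, γ₀/(24(C+1)))`, nodes `s_k = min(t₁, kδ)`, `τ₀ := (Σ_k τ₀(k) + 1) + τ₀^{tails}`,
`N₀ := Σ_k N₀(k,τ) + N₀^{tails}(τ)`; for `s'` and `k = ⌊s'/δ⌋`: change of law `λ_{s'} → λ_{s_k}`,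
split `F_{s'} = F_{s_k} + (F_{s'} − F_{s_k})`, S1 at the node with tilt `4β`, pathwise bound
`ω(N+1) + 6C·(window tails)` of the difference, then the tails. [folklore] -/
theorem stub_transferByNetsEv :
    (∃ η₀ : ℝ, 0 < η₀ ∧ ∀ (Θ U C Λ : ℝ), 1 ≤ Θ → 0 ≤ U → 0 ≤ C → 1 ≤ Λ → ∀ σ : ℝ, 0 < σ →
        ∃ β₀ : ℝ, 0 < β₀ ∧
        ∀ (a θ₀ : T3 → ℝ) (u₀ : T3 → V3), Continuous a → Continuous θ₀ → Continuous u₀ →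
        (∀ x, Λ⁻¹ ≤ a x ∧ a x ≤ Λ) → (∀ x, Θ⁻¹ ≤ θ₀ x ∧ θ₀ x ≤ Θ) → (∀ x, ‖u₀ x‖ ≤ U) →
        σ ^ 3 * (⨆ x, a x) ≤ η₀ * ∫ x, a x →
        ∀ Φ : (N : ℕ) →
          HardSphereFlow (Torus.geometry (Fin 3)) (hsDiameter σ N) (N + 1),
        ∀ (A : T3 → Fin 3 → Fin 3 → ℝ) (b : T3 → V3) (G : T3 × ℝ → ℝ),
        Continuous A → Continuous b → Continuous G →
        ∀ F : T3 × V3 → ℝ, (∀ y, F y =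
          (∑ j : Fin 3, ∑ k : Fin 3, A y.1 j k * ((y.2 - u₀ y.1) j * (y.2 - u₀ y.1) k)) +
            (∑ j : Fin 3, b y.1 j * (y.2 - u₀ y.1) j) * G (y.1, ‖y.2 - u₀ y.1‖ ^ 2)) →
        (∀ y, |F y| ≤ C * (1 + ‖y.2‖ ^ 2)) →
        (∀ x, ∫ v, F (x, v) * localMaxwellian 1 (θ₀ x) (u₀ x) v = 0) →
        (∀ x (j : Fin 3), ∫ v, F (x, v) * v j * localMaxwellian 1 (θ₀ x) (u₀ x) v = 0) →
        (∀ x, ∫ v, F (x, v) * ‖v‖ ^ 2 * localMaxwellian 1 (θ₀ x) (u₀ x) v = 0) →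
        ∀ β : ℝ, |β| ≤ β₀ → ∀ ε : ℝ, 0 < ε → ∃ τ₀ : ℝ, 0 < τ₀ ∧ ∀ τ : ℝ, τ₀ ≤ τ →
        ∃ N₀ : ℕ, ∀ N : ℕ, N₀ ≤ N →
          ∫⁻ z, ENNReal.ofReal (Real.exp (β * ∑ i : Fin (N + 1),
              (τ * ((N : ℝ) + 1) ^ (-(1 / 3 : ℝ)))⁻¹ *
                ∫ r in (0 : ℝ)..(τ * ((N : ℝ) + 1) ^ (-(1 / 3 : ℝ))), F (((Φ N).flow r z) i)))
            ∂(localGibbsLaw σ a u₀ θ₀ N (Φ N)) ≤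
          ENNReal.ofReal (Real.exp (ε * ((N : ℝ) + 1)))) →
    (∃ η : ℝ, 0 < η ∧ ∀ (t₁ : ℝ) (a θ₀ : ℝ → T3 → ℝ) (u₀ : ℝ → T3 → V3),
        Continuous (Function.uncurry a) → Continuous (Function.uncurry θ₀) →
        Continuous (Function.uncurry u₀) → (∀ s x, 0 < a s x) → (∀ s x, 0 < θ₀ s x) →
        ∀ σ : ℝ, 0 < σ → (∀ s ∈ Icc 0 t₁, σ ^ 3 * (⨆ x, a s x) ≤ η * ∫ x, a s x) →
        ∀ Φ : (N : ℕ) → HardSphereFlow (Torus.geometry (Fin 3)) (hsDiameter σ N) (N + 1),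
        ∃ γ₀ : ℝ, 0 < γ₀ ∧ ∀ γ : ℝ, 0 ≤ γ → γ ≤ γ₀ → ∀ κ : ℝ, 0 < κ → ∃ V : ℝ, 1 ≤ V ∧
        ∃ τ₀ : ℝ, 0 < τ₀ ∧ ∀ τ : ℝ, τ₀ ≤ τ → ∃ N₀ : ℕ, ∀ N : ℕ, N₀ ≤ N → ∀ s ∈ Icc 0 t₁,
          ∫⁻ z, ENNReal.ofReal (Real.exp (γ * ∑ i : Fin (N + 1),
              (τ * ((N : ℝ) + 1) ^ (-(1 / 3 : ℝ)))⁻¹ *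
                ∫ r in (0 : ℝ)..(τ * ((N : ℝ) + 1) ^ (-(1 / 3 : ℝ))),
                  max 0 (‖(((Φ N).flow r z) i).2‖ ^ 2 - V)))
            ∂(localGibbsLaw σ (a s) (u₀ s) (θ₀ s) N (Φ N)) ≤
          ENNReal.ofReal (Real.exp (κ * ((N : ℝ) + 1)))) →
    (∀ (t₁ : ℝ) (a θ₀ : ℝ → T3 → ℝ) (u₀ : ℝ → T3 → V3),
        Continuous (Function.uncurry a) → Continuous (Function.uncurry θ₀) →
        Continuous (Function.uncurry u₀) → (∀ s x, 0 < a s x) → (∀ s x, 0 < θ₀ s x) →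
        ∀ σ : ℝ, 0 < σ → σ ≤ 1 / 2 → ∀ κ : ℝ, 0 < κ → ∃ δ : ℝ, 0 < δ ∧
        ∀ Φ : (N : ℕ) → HardSphereFlow (Torus.geometry (Fin 3)) (hsDiameter σ N) (N + 1),
        ∀ N : ℕ, ∀ s ∈ Icc 0 t₁, ∀ s' ∈ Icc 0 t₁, |s - s'| ≤ δ →
        ∀ g : Config (N + 1) (Fin 3) T3 → ℝ≥0∞,
          AEMeasurable g (liouville (Torus.geometry (Fin 3)) (N + 1) (hsDiameter σ N)) →
          ∫⁻ z, g z ∂(localGibbsLaw σ (a s') (u₀ s') (θ₀ s') N (Φ N)) ≤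
            (∫⁻ z, g z ^ 2 ∂(localGibbsLaw σ (a s) (u₀ s) (θ₀ s) N (Φ N))) ^ (1 / 2 : ℝ) *
              ENNReal.ofReal (Real.exp (κ * ((N : ℝ) + 1)))) →
    (∀ (t₁ : ℝ) (a θ₀ : ℝ → T3 → ℝ) (u₀ : ℝ → T3 → V3),
        Continuous (Function.uncurry a) → Continuous (Function.uncurry θ₀) →
        Continuous (Function.uncurry u₀) → (∀ s x, 0 < a s x) → (∀ s x, 0 < θ₀ s x) →
        ∀ (A : ℝ → T3 → Fin 3 → Fin 3 → ℝ) (b : ℝ → T3 → V3) (G : ℝ → T3 × ℝ → ℝ),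
        Continuous (Function.uncurry A) → Continuous (Function.uncurry b) →
        Continuous (Function.uncurry G) →
        ∀ F : ℝ → T3 × V3 → ℝ, (∀ s y, F s y =
          (∑ j : Fin 3, ∑ k : Fin 3, A s y.1 j k * ((y.2 - u₀ s y.1) j * (y.2 - u₀ s y.1) k)) +
            (∑ j : Fin 3, b s y.1 j * (y.2 - u₀ s y.1) j) * G s (y.1, ‖y.2 - u₀ s y.1‖ ^ 2)) →
        ∃ Θ U Λ : ℝ, 1 ≤ Θ ∧ 0 ≤ U ∧ 1 ≤ Λ ∧
          (∀ s ∈ Icc 0 t₁, ∀ x, Θ⁻¹ ≤ θ₀ s x ∧ θ₀ s x ≤ Θ) ∧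
          (∀ s ∈ Icc 0 t₁, ∀ x, ‖u₀ s x‖ ≤ U) ∧
          (∀ s ∈ Icc 0 t₁, ∀ x, Λ⁻¹ ≤ a s x ∧ a s x ≤ Λ) ∧
          ∀ R : ℝ, ∀ ω : ℝ, 0 < ω → ∃ δ : ℝ, 0 < δ ∧
            ∀ s ∈ Icc 0 t₁, ∀ s' ∈ Icc 0 t₁, |s - s'| ≤ δ →
            ∀ (x : T3) (v : V3), ‖v‖ ≤ R → |F s (x, v) - F s' (x, v)| ≤ ω) →
    id KineticCurrentsLDAlongFamilies := by
  intro hK hT hR hB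
  show KineticCurrentsLDAlongFamilies; delta KineticCurrentsLDAlongFamilies
  obtain ⟨η₁, hη₁, hK'⟩ := hK
  obtain ⟨ηT, hηT, hT'⟩ := hT
  refine ⟨min η₁ (min ηT (1 / 8)), lt_min hη₁ (lt_min hηT (by norm_num)), ?_⟩
  intro t₁ a θ₀ u₀ ha hθ hu ha0 hθ0 σ hσ hguard Φ A b G hA hb hG F hC h1 hv hE
  have hFc : ∀ s, Continuous (F s) := fun s =>
    tbn_continuous_kcw (hA.uncurry_left s) (hb.uncurry_left s) (hG.uncurry_left s)
      (hu.uncurry_left s)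
  -- the degenerate parameter interval `t₁ < 0`: everything is vacuous
  by_cases ht : t₁ < 0
  · refine ⟨1, one_pos, fun β _ ε _ => ⟨1, one_pos, fun τ _ => ⟨0, fun N _ s hs => ?_⟩⟩⟩
    exact absurd (hs.1.trans hs.2) (not_le.2 ht)
  replace ht : 0 ≤ t₁ := not_lt.1 ht
  have h0 : (0 : ℝ) ∈ Icc 0 t₁ := ⟨le_rfl, ht⟩
  -- Step 1: the guard gives `σ ≤ 1/2` (at `s = 0`), the S1-guard and the tails' guard at every `s`
  have hint_le : ∀ s, ∫ x, a s x ≤ ⨆ x, a s x := fun s =>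
    KineticCurrentsWindowLDUniformSketch.integral_le_iSup_T3 (ha.uncurry_left s)
  have hint_nn : ∀ s, 0 ≤ ∫ x, a s x := fun s => integral_nonneg fun x => (ha0 s x).le
  have hguard1 : ∀ s ∈ Icc 0 t₁, σ ^ 3 * (⨆ x, a s x) ≤ η₁ * ∫ x, a s x := fun s hs =>
    (hguard s hs).trans (mul_le_mul_of_nonneg_right (min_le_left _ _) (hint_nn s))
  have hguardT : ∀ s ∈ Icc 0 t₁, σ ^ 3 * (⨆ x, a s x) ≤ ηT * ∫ x, a s x := fun s hs =>
    (hguard s hs).trans (mul_le_mul_of_nonneg_right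
      ((min_le_right _ _).trans (min_le_left _ _)) (hint_nn s))
  have hσ2 : σ ≤ 1 / 2 := by
    have h8 : σ ^ 3 * (⨆ x, a 0 x) ≤ 1 / 8 * (⨆ x, a 0 x) :=
      (hguard 0 h0).trans ((mul_le_mul_of_nonneg_right
        ((min_le_right _ _).trans (min_le_right _ _)) (hint_nn 0)).trans
        (mul_le_mul_of_nonneg_left (hint_le 0) (by norm_num)))
    have hsup_pos : 0 < ⨆ x, a 0 x :=
      lt_of_lt_of_le (ha0 0 0) (le_ciSup (isCompact_range (ha.uncurry_left 0)).bddAbove 0)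
    have h8' : σ ^ 3 ≤ (1 / 2) ^ 3 := by nlinarith
    exact le_of_pow_le_pow_left₀ (by norm_num) (by norm_num) h8'
  -- Step 2: the constants of the family (S6), the growth constant, `β₁` (S1), `γ₀` (tails)
  obtain ⟨Θ, U, Λ, hΘ1, hU0, hΛ1, hΘb, hUb, hΛb, hmod⟩ :=
    hB t₁ a θ₀ u₀ ha hθ hu ha0 hθ0 A b G hA hb hG F (fun s y => rfl)
  obtain ⟨C, hCb⟩ := hC
  have hC0 : 0 ≤ C := growthConst_nonneg (hCb 0 h0)
  obtain ⟨β₁, hβ₁, hK1⟩ := hK' Θ U C Λ hΘ1 hU0 hC0 hΛ1 σ hσ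
  obtain ⟨γ₀, hγ₀, hT1⟩ := hT' t₁ a θ₀ u₀ ha hθ hu ha0 hθ0 σ hσ hguardT Φ
  refine ⟨min (β₁ / 4) (γ₀ / (24 * (C + 1))), lt_min (by positivity) (by positivity), ?_⟩
  intro β hβ ε hε
  have hβ1 : |β| ≤ β₁ / 4 := hβ.trans (min_le_left _ _)
  have hβ2 : |β| ≤ γ₀ / (24 * (C + 1)) := hβ.trans (min_le_right _ _)
  have h4 : |4 * β| = 4 * |β| := by rw [abs_mul, abs_of_pos (by norm_num : (0 : ℝ) < 4)]
  have h4β : |4 * β| ≤ β₁ := by rw [h4]; linarith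
  -- Step 3: the window tails at rate `γ = 24|β|C`, precision `ε/4`; this also fixes the tails'
  -- window threshold `τT`
  obtain ⟨γ, hγ0, hγle, hγ4⟩ : ∃ γ : ℝ, 0 ≤ γ ∧ γ ≤ γ₀ ∧ |4 * β| * (6 * C) ≤ γ := by
    refine ⟨24 * |β| * C, by positivity, ?_, by rw [h4]; linarith⟩
    rw [le_div_iff₀ (by positivity)] at hβ2
    nlinarith [abs_nonneg β]
  obtain ⟨V, hV1, τT, hτT, hT2⟩ := hT1 γ hγ0 hγle (ε / 4) (by positivity)
  -- Step 4: the joint modulus at radius `√(2V)` and the change of reference law, precision `ε/4`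
  obtain ⟨ω, hω, hβω⟩ : ∃ ω : ℝ, 0 < ω ∧ |β| * ω ≤ ε / 4 := by
    refine ⟨ε / 4 / (|β| + 1), by positivity, ?_⟩
    rw [show |β| * (ε / 4 / (|β| + 1)) = ε / 4 * (|β| / (|β| + 1)) by ring]
    exact mul_le_of_le_one_right (by positivity) ((div_le_one (by positivity)).2 (by linarith))
  obtain ⟨δ₁, hδ₁, hmod1⟩ := hmod (Real.sqrt (2 * V)) ω hω
  obtain ⟨δ₂, hδ₂, hlaw⟩ := hR t₁ a θ₀ u₀ ha hθ hu ha0 hθ0 σ hσ hσ2 (ε / 4) (by positivity)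
  obtain ⟨δ, hδ, hδ1, hδ2⟩ : ∃ δ : ℝ, 0 < δ ∧ δ ≤ δ₁ ∧ δ ≤ δ₂ :=
    ⟨min δ₁ δ₂, lt_min hδ₁ hδ₂, min_le_left _ _, min_le_right _ _⟩
  -- Step 5: the net `s_k = min t₁ (kδ)` and the pointwise rung (S1) at every node, tilt `4β`;
  -- the window threshold is the net's plus the tails'
  obtain ⟨sk, hsk, hsk_eq⟩ : ∃ sk : ℕ → ℝ, (∀ k, sk k ∈ Icc 0 t₁) ∧
      ∀ k : ℕ, (k : ℝ) * δ ≤ t₁ → sk k = k * δ :=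
    ⟨fun k => min t₁ (k * δ), fun k => ⟨le_min ht (by positivity), min_le_left _ _⟩,
      fun k hk => min_eq_right hk⟩
  have hnet := fun k : ℕ =>
    hK1 (a (sk k)) (θ₀ (sk k)) (u₀ (sk k)) (ha.uncurry_left _) (hθ.uncurry_left _)
      (hu.uncurry_left _) (hΛb _ (hsk k)) (hΘb _ (hsk k)) (hUb _ (hsk k)) (hguard1 _ (hsk k)) Φ
      (A (sk k)) (b (sk k)) (G (sk k)) (hA.uncurry_left _) (hb.uncurry_left _)
      (hG.uncurry_left _) (F (sk k)) (fun y => rfl) (hCb _ (hsk k)) (h1 _ (hsk k))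
      (hv _ (hsk k)) (hE _ (hsk k)) (4 * β) h4β ε hε
  obtain ⟨τ₀, hτ₀, hnet'⟩ := tbn_net_thresholds (Finset.range (⌈t₁ / δ⌉₊ + 1)) hnet
  refine ⟨τ₀ + τT, by positivity, fun τ hτ => ?_⟩
  have hτpos : 0 < τ := by linarith
  obtain ⟨N₁, hN₁⟩ := hnet' τ (by linarith [hτT.le])
  obtain ⟨NT, hNT⟩ := hT2 τ (by linarith [hτ₀.le])
  refine ⟨N₁ + NT, fun N hN s' hs' => ?_⟩
  -- Step 6: the nearest node to the left of `s'`
  obtain ⟨k, hkδ, hs'k, hk_mem⟩ : ∃ k : ℕ, (k : ℝ) * δ ≤ s' ∧ s' < k * δ + δ ∧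
      k ∈ Finset.range (⌈t₁ / δ⌉₊ + 1) := by
    refine ⟨⌊s' / δ⌋₊, ?_, ?_, ?_⟩
    · have h := Nat.floor_le (div_nonneg hs'.1 hδ.le)
      rwa [le_div_iff₀ hδ] at h
    · have h := Nat.lt_floor_add_one (s' / δ)
      rw [div_lt_iff₀ hδ] at h
      linarith
    · exact Finset.mem_range.2 (Nat.lt_add_one_iff.2 ((Nat.floor_le_ceil _).trans
        (Nat.ceil_le_ceil (div_le_div_of_nonneg_right hs'.2 hδ.le))))
  have hdist : |sk k - s'| ≤ δ := by
    rw [hsk_eq k (hkδ.trans hs'.2), abs_sub_comm, abs_of_nonneg (by linarith)]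
    linarith
  have hw : 0 < τ * ((N : ℝ) + 1) ^ (-(1 / 3 : ℝ)) :=
    mul_pos hτpos (Real.rpow_pos_of_pos (by positivity) _)
  have hPgood : (localGibbsLaw σ (a (sk k)) (u₀ (sk k)) (θ₀ (sk k)) N (Φ N)) (Φ N).goodᶜ = 0 :=
    localGibbsLaw_absolutelyContinuous σ _ _ _ N (Φ N) (Φ N).measure_compl_good
  -- pointwise `|F_{s'} − F_{s_k}| ≤ ω + 6C·max 0 (‖v‖² − V)`; the window functional is measurable
  have hdiff : ∀ y, |F s' y - F (sk k) y| ≤ ω + 6 * C * max 0 (‖y.2‖ ^ 2 - V) :=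
    tbn_abs_sub_le_of_modulus hC0 hV1 hω.le (hCb _ (hsk k)) (hCb s' hs') fun x v hxv =>
      hmod1 s' hs' (sk k) (hsk k) (by rw [abs_sub_comm]; exact hdist.trans hδ1) x v hxv
  have hmeas : AEMeasurable (fun z => ENNReal.ofReal (Real.exp (β * ∑ i,
      (τ * ((N : ℝ) + 1) ^ (-(1 / 3 : ℝ)))⁻¹ * ∫ r in (0 : ℝ)..(τ * ((N : ℝ) + 1) ^ (-(1 / 3 : ℝ))),
      F s' ((Φ N).flow r z i)))) (liouville (Torus.geometry (Fin 3)) (N + 1) (hsDiameter σ N)) := by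
    refine (Real.measurable_exp.comp_aemeasurable (AEMeasurable.const_mul
      (Finset.aemeasurable_fun_sum _ fun i _ => ?_) β)).ennreal_ofReal
    exact ((Φ N).aemeasurable_intervalIntegral_comp_flow_torus
      ((hFc s').measurable.comp (measurable_pi_apply i)) 0 _ (Φ N).measure_compl_good).const_mul _
  -- (a) change of reference law `λ_{s'} → λ_{s_k}` (S5); (b) split of the square; (c) S1 at the
  -- node, tilt `4β`; (d) the difference via the tails; (e) `ε/4 + ε/4 + (4|β|ω + ε/4)/4 ≤ ε`
  have haa := hlaw Φ N (sk k) (hsk k) s' hs' (hdist.trans hδ2) _ hmeas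
  have hbb := tbn_lintegral_sq_le_split (Φ N) hPgood (hFc (sk k)) (hFc s')
    (τ * ((N : ℝ) + 1) ^ (-(1 / 3 : ℝ))) β
  have hdd := (tbn_lintegral_exp_window_sub_le (Φ N) hPgood (hFc (sk k)) (hFc s') hdiff hw
    (4 * β) (c := 4 * |β| * ω * ((N : ℝ) + 1)) (γ := γ) (by rw [Nat.cast_add_one, h4]) hγ4).trans
    (mul_le_mul' le_rfl (hNT N ((Nat.le_add_left NT N₁).trans hN) (sk k) (hsk k)))
  exact tbn_chain_le haa hbb (hN₁ N ((Nat.le_add_right N₁ NT).trans hN) k hk_mem) hdd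
    (by positivity) (by linarith)

end Summit.AtomisticToContinuum.HydrodynamicLimit.Theorems.KineticCurrentsLDAlongFamiliesSketch

end
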